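import Literature.AnabelianGeometry.EtaleTheta.SettingModel
import Literature.AnabelianGeometry.EtaleTheta.SettingBridge
import HarnessLib

/-!
# [EtTh] §1: the once-punctured bridge parameters `OncePuncturedData` are EMPTY over the root model
# `ThetaSetting.model p` (NV-L2 census certificate) — and what any inhabitant entails

Mochizuki, *The étale theta function and its Frobenioid-theoretic manifestations*, Publ. RIMS **45**
(2009), §1, PRIMS PDF p. 11 ("`X^log` a stable log curve of type `(1,1)`"), p. 13 ("any decomposition
group of a cusp of `Y^log`"), p. 15 ("the divisor of cusps") [cite: MochizukiEtTh2009, §1 p.13].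

Cell abc-iut, layer L2 (seat abc-iut-L2-t7, author lineage of `ThetaSetting.OncePuncturedData`,
`SettingBridge.lean`); row NV-L2/`ThetaSetting.OncePuncturedData` of the inhabitation census v2 (seat
abc-iut-w5-d029). PROOF-ONLY (0 definitions). `OncePuncturedData D` is the PARAMETER bundle of the bridge
`ThetaSetting → OncePuncturedTemperedGroup` (group-level data `GroupLevelData` + (P1) `Ker(Π_X → G_{ℚ_p}) =
Δ_X` + (P2) a cusp exists + (P3) cusp decomposition groups lie in `Π^tp_Y` + (P4) they map onto `G_K` +
(P5) the guard `IsEtThOrigin`). Recorded here: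

* `OncePuncturedData.nonempty_pt` / `isEmpty_oncePuncturedData_of_isEmpty_pt` — an inhabitant forces a
  closed point (indeed a cusp, (P2)); so over any setting WITHOUT closed points the bundle is empty;
* `ThetaSetting.model_isEmpty_oncePuncturedData` — **at the root model `ThetaSetting.model p`
  (`SettingModel.curve p`: `Pt := PEmpty`, "no closed points") the bundle is EMPTY**: the census row is
  «vacuous-by-emptiness at the root», un-vacated only by a §1 model with a cusp.

EMPTY-at-the-toy ≠ vacuous-in-print; nothing of [EtTh] is asserted; typed ≠ endorsed; no side is taken
on any disputed claim.
-/

noncomputable section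

namespace Literature.AnabelianGeometry.EtaleTheta

open Literature.AnabelianGeometry.SemiGraphs

namespace ThetaSetting

variable {p : ℕ} [Fact p.Prime] {D : ThetaSetting p}

/-- An inhabitant of the bridge parameters yields a cusp, in particular a closed point ((P2) "the divisor
of cusps", p. 15). [cite: MochizukiEtTh2009, §1 p.15] -/
theorem OncePuncturedData.nonempty_pt (e : D.OncePuncturedData) : Nonempty D.Pt := by
  obtain ⟨x, -⟩ := e.exists_cusp
  exact ⟨x⟩

/-- Over a setting without closed points the bridge parameters are empty. [cite: MochizukiEtTh2009, §1 p.15] -/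
theorem isEmpty_oncePuncturedData_of_isEmpty_pt (h : IsEmpty D.Pt) : IsEmpty D.OncePuncturedData :=
  ⟨fun e => h.false (Classical.choice e.nonempty_pt)⟩

/-- Over a setting without cusps the bridge parameters are empty. [cite: MochizukiEtTh2009, §1 p.15] -/
theorem isEmpty_oncePuncturedData_of_not_isCusp (h : ∀ x : D.Pt, ¬ D.IsCusp x) :
    IsEmpty D.OncePuncturedData :=
  ⟨fun e => by
    obtain ⟨x, hx⟩ := e.exists_cusp
    exact h x hx⟩

variable (p) in
/-- **NV-L2 census certificate**: over the root model `ThetaSetting.model p` (`K := ℚ_p`,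
`Π^tp_X := F₂ × G_{ℚ_p}`, NO closed points: `Pt := PEmpty`) the once-punctured bridge parameters
`OncePuncturedData` are EMPTY — field (P2) `exists_cusp` fails. The row is vacuous-by-emptiness at the
root; a §1 model WITH a cusp is needed to un-vacate it. [cite: MochizukiEtTh2009, §1 p.13] -/
theorem model_isEmpty_oncePuncturedData : IsEmpty (ThetaSetting.model p).OncePuncturedData :=
  isEmpty_oncePuncturedData_of_isEmpty_pt (by change IsEmpty PEmpty; infer_instance)

variable (p) in
/-- Equivalently: `¬ Nonempty (ThetaSetting.model p).OncePuncturedData`. [cite: MochizukiEtTh2009, §1 p.13] -/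
theorem model_not_nonempty_oncePuncturedData : ¬ Nonempty (ThetaSetting.model p).OncePuncturedData :=
  not_nonempty_iff.mpr (model_isEmpty_oncePuncturedData p)

end ThetaSetting

end Literature.AnabelianGeometry.EtaleTheta

end
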